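import Summits.QuantumFields.YangMills.Theorems.BalabanUVNodesN27AtKernelPinnedReading13CoPHFSC
import Summits.QuantumFields.YangMills.Theorems.BalabanUVNodesN16PinnedLayer13CoPH
import Summits.QuantumFields.YangMills.Theorems.BalabanUVNodesN14SourceTowerOfRecord
import Summits.QuantumFields.YangMills.Theorems.BalabanUVNodesN15FullPropagatorSizedRecord

/-!
# BalabanUVNodes ∕ N27 = binder B5 AT THE RECORD — module (Kᴸᴾ): THE QUADRUPLE-PINNED BILLS OF (Kᴬ) §3 ∕ (Kꜰ) §3 WITH NODE N16's PIN IN THE SKELETON v5 CURRENCY — dag-n16-e's NAMED PINS of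
# module 43 `…N16PinnedLayer13CoPH` (p600861): the CONST pin `N16PinnedConst 𝔯 ℓ₃` (= (Kᴬ)∕(Kꜰ)'s raw `hpin3`, by name) and ★ the (C1)(i) LOOSE pin `N16PinnedLoose 𝔯 ℓ₃ B` (plan g82 K3V5-PRECUT
# 7ea7f0e25e496001: v5's `GuardedReadingN16 := GuardedReading ∧ N16PinnedLoose 𝔯 ℓ₃ B ∧ N16LettersEnd 2 g ℓ₃ ∧ N16RadiusMatch ℓ₃ B`), the N16 row then ONE per-family `N16HolderAt … β` at the LOOSE-DATA
# object `{ne3ConstLayerOfRecord₁₁ F N (ℓ₃ F) with dom := ball of radius (ℓ₃ F).ε ∕ B F}` (dag-n16-w1's object), by this seat's lineage faces `s_N16Holder_rRec₁₃CoPHOn_iff_of_constLayer` (dag-n16-e) at that object;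
# and the other three pins IN v5's OWN NAMES: NODE O ↦ `YMDAG.N14.TopBorn.Ne1PinnedOfRecord 𝔯` (dag-n14-w1 FILE 3, v4∕v5 (t-N14)), N15 ↦ the body of v5's `N15PinnedSized 𝔯` (dag-n15-a's SIZED GENUINE
# objects `fullGSizedObjects 3 F.hL b a_S ν μ α β c₃₅ p`, spelled — the kit def is not importable), node U3 ↦ the body of v5's `U3PinnedKernels 𝔯 ℓ` (`hpin`); the U3 rows read off def-W1's four
# finite-volume kernel letters; over (K) §2 ∕ (Kꜰ) §2 BY NAME — so THE BILL BELOW IS LITERALLY «v5's `GuardedReadingN16` pins ⟹ what stub 1's rates still cost»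
# (cell `pub-ymgap`, HUMAN RULING D-0062 Track A; director-ym №197 ∕ HUMAN RULING D-0149; width seat `pub-ymgap-dag-n27-w1` gen 2 on NODE n27 (B5 composite); K3⁷
# `SpineGivenEndpointR13SepCoPH` = stmt-QuantumFields-20544, `--kind proof --supports 20544 --as helper`; COUNT-NEUTRAL; THEOREMS ONLY, 0 `def`, 0 `sorry`; `N`-generic, guard-generic, NO Theses
# import, does NOT import the skeleton; regime modules only — leaves are dag-n27-c's, dag-lead DEDUP-372 §n27 ownership note v60)

WHAT IS KERNEL-CHECKED ([bookkeeping]; THREE theorems).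
* `s_N16Holder_rRec₁₃CoPHOn_of_pinnedLoose` — under `N16PinnedLoose 𝔯 ℓ₃ B`, the per-family sentence `N16HolderAt (ne3OfRecord₁₁ F ⟨loose object⟩) β` on the guarded families gives
  `S_N16Holder β (RRec₁₃CoPHOn 𝔯 Rg)` (dag-n16-e `s_N16Holder_rRec₁₃CoPHOn_iff_of_constLayer` at the loose object).
* ★★★ `spine_rec13CCoPHOn_holder_of_v5pins_of_letters` — (Kᴬ) §3's image AT v5's PINS: N27 = B5 at `IsRecordOfRecord₁₃CCoPHOn F N Rg` from `Ne1PinnedOfRecord 𝔯` · the `N15PinnedSized` body ·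
  `N16PinnedLoose 𝔯 ℓ₃ B` · the `U3PinnedKernels` body, `h16` per guarded family at the loose object, def-W1's four letters + `Signs ∕ 0 < κ ∕ betaPrime510 4 1 κ ≤ cr`, K5 stubs `h20 h21` at the regime spine
  home, `hx`, `h19` (∀-`g₀` N19′ edge) — (K) §2 BY NAME; N14 ∕ N15 OUTRIGHT behind their pins (dag-n14-w1 `guard_and_s_N14_of_ne1PinnedOfRecord`, dag-n15-a `s_N15_rRec₁₃CoPHOn_of_fullGSizedReading`).
* ★★★ `hybridNE7Under_of_v5pins_fsc_of_letters` — (Kꜰ) §3's image AT v5's PINS in v4∕v5's FULL-PREFIX keying: per guarded admissible tuple `HybridNE7Under (datumOfRecord₁₃CoPH F N θ hP) END` from the four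
  pins, `h16` at the loose object, the four letters + `Signs ∕ 0 < κ ∕ betaPrime510 4 1 κ ≤ cr ∕ 0 ≤ ρ < 1`, θ-form `h20 h21`, the FSC-keyed N19′ face at the spelled `PHolderD4 β` (selector `ksel`), `hx` —
  i.e. GIVEN `GuardedReadingN16 𝔯 ksel ℓ ℓ₃ g B`'s pins (its `KeyedLive` guard and `N16LettersEnd ∕ N16RadiusMatch` rows are NOT read by B5), stub 1's `KeyedRatesHolderD4 β (rrOfRecord 𝔯 ksel)` CONTENT
  that B5 still needs is: `h16` + the four kernel letters + the letter rows; and stub 2's content is `h20 h21 h19 hx` at a `cr` of the prover's choosing.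

HONEST FRAMING.  COMPOSITE-node bookkeeping BY NAME; a REDUCTION, not a discharge: the pins are HYPOTHESES on a free `𝔯` (no reading minted); N14 ∕ N15 behind their pins are DECIDED MODELS (n14-w1's «budget
only» tower under reading (a); dag-n15-c's carriers), NOT Bałaban's objects (v5's N14 pin reads the datum's scheme — «model-level vs object» is the label question of record, n14-w1 l.27241; the N15 pin is MODEL LEVEL per v5's own docstring);
the N16 row at the loose-data object is THE END's content under dag-n16-w1's Thm-1 road (hypothesis here; `B` a free letter —
`B → ∞` = near-flat data only, content-poor, as the plan says); def-W1's four kernel letters, NE7-cluster, K5, the N19′ edge are hypotheses inhabited for no family today (K0⁷ OPEN); β ∕ `ℓ.ρ` LETTERS;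
nothing of Bałaban's asserted or instantiated; no `Provisos₁₃CoPH` inhabitant; NOT `stub_rates13H` ∕ `stub_expansion13H` (no stub closed or claimed); N14–N18 ∕ N22 ∕ N27 NOT discharged; K3⁷ OPEN; skeleton
v4 17c74fac127b5f61 ∕ the v5 draft UNTOUCHED; counts UNMOVED (typed 28∕28 · discharged 5∕27, A 5∕28); one finite four-torus programme at fixed `ε` — R4 closes the conditional rung `BalabanLadder.UV` only:
NOT ℝ⁴, NOT infinite volume, NOT OS, NOT a mass gap, NOT Clay.  No decl below carries a cite tag.
-/

set_option autoImplicit false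

namespace Summit.QuantumFields.YangMills.Theorems.BalabanUVNodesN27SpineRecord

open scoped Matrix.Norms.L2Operator
open Literature.MathematicalPhysics.QuantumFieldTheory.Balaban1983to89
open Literature.MathematicalPhysics.QuantumFieldTheory.Balaban1983to89.T4Continuum
open Literature.MathematicalPhysics.QuantumFieldTheory.Balaban1983to89.B12Sec2to5 (betaPrime510)
open Literature.MathematicalPhysics.QuantumFieldTheory.Balaban1983to89.Node00.U3OfKernels (objectsOfRecord₁₃)
open Literature.MathematicalPhysics.QuantumFieldTheory.Balaban1983to89.Node00.U3KernelLetters (PolLimitsExistOfRecord₁₃ WindowedNE9OfRecord₁₃ WindowedDecayOfRecord₁₃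
  WindowedStepRateOfRecord₁₃)
open T4WeightBudget (RelWeightBound)
open T4IndicatorShell (ShellWeightBound)
open T4ContinuumYM4Torus (ForSmallCouplings)
open T4ApexHybrid (HybridNE7Under)
open Summit.QuantumFields.BalabanUV.T4Continuum
open Summit.QuantumFields.BalabanUV.T4Continuum.Spine
open MinimalActionRate (sfClass)
open YMDAG.UVSplit
open YMDAG.N14.TopBorn (Ne1PinnedOfRecord guard_and_s_N14_of_ne1PinnedOfRecord n14At_rateCarriersOfRecord₁₃CoPH_of_pinned)
open Summit.QuantumFields.YangMills.BalabanUVNodes.N15.GenuineRecord (fullGSizedObjects n15At_fullGSizedObjects_family)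
open Node00 (Stage13HParams datumOfRecord₁₃CoPH U3Letters₁₁ NE3Letters₁₁ NE3Objects₁₁ ne3ConstLayerOfRecord₁₁ ne3NperOfRecord₁₁ ne3DomOfRecord₁₁)
open Summit.QuantumFields.YangMills.BalabanUVNodes.N16HolderDefs (N16HolderAt S_N16Holder)
open Summit.QuantumFields.YangMills.BalabanUVNodes.N16AtRRec13CoPHLines (s_N16Holder_rRec₁₃CoPHOn_iff_of_constLayer)
open Summit.QuantumFields.YangMills.BalabanUVNodes.N16PinnedLayer13CoPH (N16PinnedLoose rateCarriers_ne3_of_pinnedLoose)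
open Summit.QuantumFields.YangMills.BalabanUVNodes.N15.AtKeyedHome (neZero_blockFactor)
open Summit.QuantumFields.YangMills.BalabanUVNodes.N15.AtReadingOfRecord13CoPH (s_N15_rRec₁₃CoPHOn_of_fullGSizedReading)
open Summit.QuantumFields.YangMills.BalabanUVNodes.SpineRatesHolder (RatesHolderAt)

variable {N : ℕ} [NeZero N]

/-! ## §1 The N16 row at the regime home under the LOOSE pin -/

/-- **`S_N16Holder β (RRec₁₃CoPHOn 𝔯 Rg)` UNDER THE LOOSE PIN FROM ONE SENTENCE PER GUARDED FAMILY AT THE LOOSE-DATA OBJECT** (dag-n16-e `s_N16Holder_rRec₁₃CoPHOn_iff_of_constLayer` at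
`o F := {ne3ConstLayerOfRecord₁₁ F N (ℓ₃ F) with dom := …}` — the loose pin IS a constant-layer pin with that object). [bookkeeping] -/
theorem s_N16Holder_rRec₁₃CoPHOn_of_pinnedLoose (𝔯 : RateReading₁₃CoPH N) (Rg : (F : T4Family) → Stage13HParams F N → Prop) (ℓ₃ : T4Family → NE3Letters₁₁)
    (B : T4Family → ℝ) (β : ℝ) (hL : N16PinnedLoose 𝔯 ℓ₃ B)
    (h16 : ∀ (F : T4Family), (∃ θ : Stage13HParams F N, θ.Provisos₁₃CoPH F N ∧ Rg F θ ∧ θ.Admissible F N) →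
      N16HolderAt (ne3OfRecord₁₁ F { ne3ConstLayerOfRecord₁₁ F N (ℓ₃ F) with
        dom := {V | V ∈ ne3DomOfRecord₁₁ F N 0 0 ∧ V ∈ sfClass 4 F.L (ne3NperOfRecord₁₁ F 0 0) ((ℓ₃ F).ε / B F) 0} }) β) :
    S_N16Holder β (RRec₁₃CoPHOn 𝔯 Rg) :=
  (s_N16Holder_rRec₁₃CoPHOn_iff_of_constLayer β 𝔯 Rg
      (fun F => { ne3ConstLayerOfRecord₁₁ F N (ℓ₃ F) with
        dom := {V | V ∈ ne3DomOfRecord₁₁ F N 0 0 ∧ V ∈ sfClass 4 F.L (ne3NperOfRecord₁₁ F 0 0) ((ℓ₃ F).ε / B F) 0} })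
      hL).2 h16

/-! ## §2 The bills at v5's four pins (N16 LOOSE) -/

section V5Pins

variable (cr : (F : T4Family) → (θ : Stage13HParams F N) → θ.Provisos₁₃CoPH F N → (ℕ → ℝ) → List (ULoop F) → SpineCarriers) (𝔯 : RateReading₁₃CoPH N)
  (Rg : (F : T4Family) → Stage13HParams F N → Prop) (ℓ : (F : T4Family) → Stage13HParams F N → U3Letters₁₁) (ℓ₃ : T4Family → NE3Letters₁₁) (B : T4Family → ℝ)
  (s : (F : T4Family) → Stage13HParams F N → ℕ) (β : ℝ)
  -- v5's FOUR PINS, BY NAME ∕ BODY: NODE O ↦ `Ne1PinnedOfRecord 𝔯` · N15 ↦ the `N15PinnedSized 𝔯` body (sized genuine objects) · N16 ↦ `N16PinnedLoose 𝔯 ℓ₃ B` · node U3 ↦ the `U3PinnedKernels 𝔯 ℓ` body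
  (hpin1 : Ne1PinnedOfRecord 𝔯)
  (hpin2 : ∃ (b aS : ℝ) (ν μ α β' : Fin 4) (c35 p : ℝ), 0 < b ∧ 0 < aS ∧
    ∀ (F : T4Family) (θ : Stage13HParams F N) (hP : θ.Provisos₁₃CoPH F N) (g₀ : ℕ → ℝ) (os : List (ULoop F)) (k : ℕ),
      (𝔯.lit F θ hP g₀ os).ne2 k = haveI := neZero_blockFactor F; fullGSizedObjects 3 F.hL b aS ν μ α β' c35 p)
  (hpinL : N16PinnedLoose 𝔯 ℓ₃ B)
  (hpin : ∀ (F : T4Family) (θ : Stage13HParams F N) (hP : θ.Provisos₁₃CoPH F N) (g₀ : ℕ → ℝ) (os : List (ULoop F)),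
    (𝔯.lit F θ hP g₀ os).u3 = objectsOfRecord₁₃ F N θ.toStage13Params (ℓ F θ))
  -- N16 at exponent β at the LOOSE-DATA object, one sentence per guarded family
  (h16 : ∀ (F : T4Family), (∃ θ : Stage13HParams F N, θ.Provisos₁₃CoPH F N ∧ Rg F θ ∧ θ.Admissible F N) →
    N16HolderAt (ne3OfRecord₁₁ F { ne3ConstLayerOfRecord₁₁ F N (ℓ₃ F) with
      dom := {V | V ∈ ne3DomOfRecord₁₁ F N 0 0 ∧ V ∈ sfClass 4 F.L (ne3NperOfRecord₁₁ F 0 0) ((ℓ₃ F).ε / B F) 0} }) β)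
  -- the U3 letter block's rows and def-W1's four kernel letters, per guarded tuple
  (hs : ∀ (F : T4Family) (θ : Stage13HParams F N), θ.Provisos₁₃CoPH F N → Rg F θ → θ.Admissible F N → (ℓ F θ).Signs)
  (hκ : ∀ (F : T4Family) (θ : Stage13HParams F N), θ.Provisos₁₃CoPH F N → Rg F θ → θ.Admissible F N → 0 < (ℓ F θ).κ)
  (hcr : ∀ (F : T4Family) (θ : Stage13HParams F N), θ.Provisos₁₃CoPH F N → Rg F θ → θ.Admissible F N → betaPrime510 4 1 (ℓ F θ).κ ≤ (ℓ F θ).cr)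
  (hL : ∀ (F : T4Family) (θ : Stage13HParams F N), θ.Provisos₁₃CoPH F N → Rg F θ → θ.Admissible F N → PolLimitsExistOfRecord₁₃ F N θ.toStage13Params)
  (h9 : ∀ (F : T4Family) (θ : Stage13HParams F N), θ.Provisos₁₃CoPH F N → Rg F θ → θ.Admissible F N → WindowedNE9OfRecord₁₃ F N θ.toStage13Params (ℓ F θ).κ (ℓ F θ).moduli)
  (hW : ∀ (F : T4Family) (θ : Stage13HParams F N), θ.Provisos₁₃CoPH F N → Rg F θ → θ.Admissible F N → WindowedDecayOfRecord₁₃ F N θ.toStage13Params 0 1 (ℓ F θ).κ)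
  (hS : ∀ (F : T4Family) (θ : Stage13HParams F N), θ.Provisos₁₃CoPH F N → Rg F θ → θ.Admissible F N →
    WindowedStepRateOfRecord₁₃ F N θ.toStage13Params (s F θ) (ℓ F θ).κ (ℓ F θ).θ₅ ((ℓ F θ).C₅ * (ℓ F θ).θ₅))
  -- the spine-side representation
  (hx : ∀ (F : T4Family) (θ : Stage13HParams F N) (hP : θ.Provisos₁₃CoPH F N), Rg F θ → θ.Admissible F N →
    B16.EndStatementBPrinted (datumOfRecord₁₃CoPH F N θ hP).C → DagBinding.EndpointExistence (datumOfRecord₁₃CoPH F N θ hP).C.toB12 →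
      ForSmallCouplings (datumOfRecord₁₃CoPH F N θ hP) fun g₀ => ∀ os : List (ULoop F),
        0 < (cr F θ hP g₀ os).l₀ ∧ 0 < (cr F θ hP g₀ os).vol ∧
        (∀ (K : ℕ) (t : ℝ), |t| ≤ (cr F θ hP g₀ os).l₀ →
          T4GenFunBounds.schemeZ ((datumOfRecord₁₃CoPH F N θ hP).scheme g₀) os ((cr F θ hP g₀ os).K₀ + K) t =
            ∑ τ ∈ (cr F θ hP g₀ os).T K, (cr F θ hP g₀ os).A K t τ) ∧
        (∀ (K : ℕ) (t : ℝ), |t| ≤ (cr F θ hP g₀ os).l₀ →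
          T4GenFunBounds.schemeZ ((datumOfRecord₁₃CoPH F N θ hP).scheme g₀) os ((cr F θ hP g₀ os).K₀ + K + 1) t =
            ∑ τ ∈ (cr F θ hP g₀ os).T K, (cr F θ hP g₀ os).B K t τ))
include hpin1 hpin2 hpinL hpin h16 hs hκ hcr hL h9 hW hS hx

/-- ★★★ **THE v5-PINNED BILL, ∀-`g₀` EDITION** ((Kᴬ) §3 at v5's pins: `Ne1PinnedOfRecord 𝔯` · the `N15PinnedSized` body · `N16PinnedLoose 𝔯 ℓ₃ B` · the `U3PinnedKernels` body; N14 ∕ N15 OUTRIGHT behind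
their pins, N16-at-β ONE sentence per guarded family at the loose-data object, the U3 rows off def-W1's four letters; (K) §2 BY NAME).  NOT a discharge; no stub closed. [bookkeeping] -/
theorem spine_rec13CCoPHOn_holder_of_v5pins_of_letters (h20 : S_N20 (SRec₁₃CoPHOn cr Rg)) (h21 : S_N21 (SRec₁₃CoPHOn cr Rg))
    (h19 : ∀ (F : T4Family) (θ : Stage13HParams F N) (hP : θ.Provisos₁₃CoPH F N), Rg F θ → θ.Admissible F N → ∀ (g₀ : ℕ → ℝ) (os : List (ULoop F)),
      (∀ k : ℕ, RatesHolderAt (datumOfRecord₁₃CoPH F N θ hP) (rateCarriersOfRecord₁₃CoPH 𝔯 F θ hP g₀ os k) β) → letI := (cr F θ hP g₀ os).dec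
        ∃ δ : ℕ → ℝ, NE7.Core (cr F θ hP g₀ os).l₀ (cr F θ hP g₀ os).vol (cr F θ hP g₀ os).T (cr F θ hP g₀ os).Bad
          (fun K t τ => (cr F θ hP g₀ os).A K t τ - (cr F θ hP g₀ os).shA K t τ) (fun K t τ => (cr F θ hP g₀ os).B K t τ - (cr F θ hP g₀ os).shB K t τ) δ ∧
          Summable δ) :
    Spine (N := N) fun F D w => Node00.IsRecordOfRecord₁₃CCoPHOn F N Rg D w := by
  obtain ⟨b, aS, ν, μ, α, β', c35, p, hb, haS, h2⟩ := hpin2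
  exact spine_rec13CCoPHOn_holder_of_kernels_pin cr β 𝔯 Rg ℓ hpin (guard_and_s_N14_of_ne1PinnedOfRecord 𝔯 Rg hpin1).2
    (s_N15_rRec₁₃CoPHOn_of_fullGSizedReading hb haS ν μ α β' c35 p 𝔯 Rg fun F θ hP _ _ g₀ os k => h2 F θ hP g₀ os k)
    (s_N16Holder_rRec₁₃CoPHOn_of_pinnedLoose 𝔯 Rg ℓ₃ B β hpinL h16)
    (n18At_kernels_of_letters_guarded Rg ℓ s hL hS) (n22At_kernels_of_letters_guarded Rg ℓ hs hL h9) hs hκ hcr (kernelDecayOfRecord₁₃_of_letters_guarded Rg ℓ hL hW) h20 h21 hx h19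

/-- ★★★ **THE v5-PINNED BILL IN v4∕v5's FULL-PREFIX KEYING** ((Kꜰ) §3's image at v5's pins: the FSC-keyed reading-layer binder discharged behind `Ne1PinnedOfRecord 𝔯` (dag-n14-w1
`n14At_rateCarriersOfRecord₁₃CoPH_of_pinned`), the `N15PinnedSized` body (dag-n15-a `n15At_fullGSizedObjects_family`) and `N16PinnedLoose 𝔯 ℓ₃ B` (module 43 `rateCarriers_ne3_of_pinnedLoose` + `h16`)):
per guarded admissible tuple `HybridNE7Under (datumOfRecord₁₃CoPH F N θ hP) END` from def-W1's four letters + `Signs ∕ 0 < κ ∕ betaPrime510 4 1 κ ≤ cr ∕ 0 ≤ ρ < 1` + `h16` + θ-form `h20 h21` + the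
FSC-keyed N19′ face at the spelled `PHolderD4 β` (selector `ksel`) + `hx` — GIVEN `GuardedReadingN16`'s pins, this is what K3⁷ still costs.  NOT a discharge; no stub closed. [bookkeeping] -/
theorem hybridNE7Under_of_v5pins_fsc_of_letters
    (ksel : (F : T4Family) → (θ : Stage13HParams F N) → θ.Provisos₁₃CoPH F N → (ℕ → ℝ) → List (ULoop F) → ℕ)
    (h20 : ∀ (F : T4Family) (θ : Stage13HParams F N) (hP : θ.Provisos₁₃CoPH F N), Rg F θ → θ.Admissible F N → ∀ (g₀ : ℕ → ℝ) (os : List (ULoop F)),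
      RelWeightBound (cr F θ hP g₀ os).l₀ (cr F θ hP g₀ os).T (cr F θ hP g₀ os).A (cr F θ hP g₀ os).B (cr F θ hP g₀ os).Bad (cr F θ hP g₀ os).W)
    (h21 : ∀ (F : T4Family) (θ : Stage13HParams F N) (hP : θ.Provisos₁₃CoPH F N), Rg F θ → θ.Admissible F N → ∀ (g₀ : ℕ → ℝ) (os : List (ULoop F)),
      ShellWeightBound (cr F θ hP g₀ os).l₀ (cr F θ hP g₀ os).T (cr F θ hP g₀ os).A (cr F θ hP g₀ os).B (cr F θ hP g₀ os).shA (cr F θ hP g₀ os).shB (cr F θ hP g₀ os).Wsh)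
    (hρ : ∀ (F : T4Family) (θ : Stage13HParams F N), θ.Provisos₁₃CoPH F N → Rg F θ → θ.Admissible F N → 0 ≤ (ℓ F θ).ρ ∧ (ℓ F θ).ρ < 1)
    (h19 : ∀ (F : T4Family) (θ : Stage13HParams F N) (hP : θ.Provisos₁₃CoPH F N), Rg F θ → θ.Admissible F N →
      B16.EndStatementBPrinted (datumOfRecord₁₃CoPH F N θ hP).C → DagBinding.EndpointExistence (datumOfRecord₁₃CoPH F N θ hP).C.toB12 →
        ForSmallCouplings (datumOfRecord₁₃CoPH F N θ hP) fun g₀ => ∀ os : List (ULoop F),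
          (RatesHolderAt (datumOfRecord₁₃CoPH F N θ hP) (rateCarriersOfRecord₁₃CoPH 𝔯 F θ hP g₀ os (ksel F θ hP g₀ os)) β ∧
              ReadOutAt (datumOfRecord₁₃CoPH F N θ hP) (rateCarriersOfRecord₁₃CoPH 𝔯 F θ hP g₀ os (ksel F θ hP g₀ os)).u3 ∧
              (0 ≤ (rateCarriersOfRecord₁₃CoPH 𝔯 F θ hP g₀ os (ksel F θ hP g₀ os)).u3.ρ ∧ (rateCarriersOfRecord₁₃CoPH 𝔯 F θ hP g₀ os (ksel F θ hP g₀ os)).u3.ρ < 1)) →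
            letI := (cr F θ hP g₀ os).dec
            ∃ δ : ℕ → ℝ, NE7.Core (cr F θ hP g₀ os).l₀ (cr F θ hP g₀ os).vol (cr F θ hP g₀ os).T (cr F θ hP g₀ os).Bad
              (fun K t τ => (cr F θ hP g₀ os).A K t τ - (cr F θ hP g₀ os).shA K t τ) (fun K t τ => (cr F θ hP g₀ os).B K t τ - (cr F θ hP g₀ os).shB K t τ) δ ∧
              Summable δ)
    (F : T4Family) (θ : Stage13HParams F N) (hP : θ.Provisos₁₃CoPH F N) (hG : Rg F θ) (hθ : θ.Admissible F N) :
    HybridNE7Under (datumOfRecord₁₃CoPH F N θ hP) (DagBinding.EndpointExistence (datumOfRecord₁₃CoPH F N θ hP).C.toB12) := by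
  obtain ⟨b, aS, ν, μ, α, β', c35, p, hb, haS, h2⟩ := hpin2
  exact hybridNE7Under_of_kernels_pin_fsc_of_letters cr 𝔯 ksel (fun {F} θ => Rg F θ) ℓ s β hpin
    (fun F θ hP hG hθ _ _ => ForSmallCouplings.of_forall fun g₀ os => by
      refine ⟨n14At_rateCarriersOfRecord₁₃CoPH_of_pinned 𝔯 hpin1 F θ hP g₀ os (ksel F θ hP g₀ os), ?_, ?_⟩
      · show N15At (ne2OfRecord₁₁ ((𝔯.lit F θ hP g₀ os).ne2 (ksel F θ hP g₀ os)))
        rw [h2 F θ hP g₀ os]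
        exact n15At_fullGSizedObjects_family hb haS ν μ α β' c35 p F
      · show N16HolderAt (rateCarriersOfRecord₁₃CoPH 𝔯 F θ hP g₀ os (ksel F θ hP g₀ os)).ne3 β
        rw [rateCarriers_ne3_of_pinnedLoose hpinL]
        exact h16 F ⟨θ, hP, hG, hθ⟩)
    hs hκ hcr hρ h20 h21 h19 hx hL h9 hW hS F θ hP hG hθ

end V5Pins

end Summit.QuantumFields.YangMills.Theorems.BalabanUVNodesN27SpineRecord
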